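import Literature.NumberTheory.Sieve.MaynardTao
import HarnessLib

/-!
# Proof of the Polymath 8b upper bound `M_k ≤ (k/(k-1)) log k` (`maynardFunctional_le_holds`)

Trunk: AntSieve. Discharge of the named fact `Literature.NumberTheory.Sieve.maynardFunctional_le` stated in
`Literature/NumberTheory/Sieve/MaynardTao.lean` (D. H. J. Polymath, *Variants of the Selberg
sieve, and bounded intervals containing many primes*, Res. Math. Sci. 1:12 (2014) = arXiv:1407.4897,
§6: Lemma 6.1 (Cauchy–Schwarz) and Corollary 6.4, p. 24 of the arXiv version).

The printed proof: with `G_m(t) := ((k-1)/log k) · (1 - t_1 - ⋯ - t_k + k t_m)⁻¹` one has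
`∫₀^∞ G_m dt_m ≤ 1` on every fibre meeting `R_k` and `∑ₘ 1/G_m = (k/(k-1)) log k` on `R_k`;
Cauchy–Schwarz on each fibre gives `(∫ F dt_m)² ≤ ∫ F²/G_m dt_m`, integrating over the other
coordinates `J_k^{(m)}(F) ≤ ∫_{R_k} F²/G_m` (Lemma 6.1), and summing over `m` gives
`∑ₘ J_k^{(m)}(F) ≤ (k/(k-1)) log k · I_k(F)` (Corollary 6.4).

Implementation notes.
* The fibre inequality is proved in `ℝ≥0∞` (`MaynardTao.ofReal_sq_integral_le`: Hölder
  `ENNReal.lintegral_mul_le_Lp_mul_Lq` with exponents `2, 2`, and the substitution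
  `∫₀^a du/(a + (k-1)u) = log k/(k-1)`, `MaynardTao.integral_inv_add_mul`), so that no fibrewise
  integrability of `F²` is needed.
* In `MaynardTao.maynardJ_le` the coordinate `t_m` is split off with the volume-preserving
  `MeasurableEquiv.piFinSuccAbove` (`e.symm (x, s) = Fin.insertNth m x s`,
  `Function.update (Fin.insertNth m x s) m u = Fin.insertNth m u s`); the cube `[0,1]^k` is
  enlarged to `{t | t_m ∈ [0,1]}`, whose preimage is `[0,1] × ℝ^{k-1}`, and the fibres are
  reassembled by Tonelli (`MeasureTheory.lintegral_prod_symm`).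
* Finally `∑ₘ (1 - ∑ᵢ tᵢ + k t_m) = k` pointwise, and `I_k(F) = ∫ F²` since `F = 0` off `R_k`.
-/

noncomputable section

open MeasureTheory Set Filter
open scoped ENNReal

namespace Literature.NumberTheory.Sieve

namespace MaynardTao

/-- `∫₀^a du / (a + K u) = log (K + 1) / K` for `a, K > 0` (Polymath 8b, proof of Cor. 6.4:
the normalisation `∫₀^∞ G_i dt_i ≤ 1`). [cite: Polymath8b2014, proof of Corollary 6.4] -/
theorem integral_inv_add_mul {a K : ℝ} (ha : 0 < a) (hK : 0 < K) :
    ∫ u in (0:ℝ)..a, (a + K * u)⁻¹ = Real.log (K + 1) / K := by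
  have h1 : (fun u : ℝ => (a + K * u)⁻¹) = fun u => (fun x : ℝ => x⁻¹) (K * u + a) := by
    ext u; rw [add_comm]
  rw [h1, intervalIntegral.integral_comp_mul_add (fun x : ℝ => x⁻¹) hK.ne' a, mul_zero, zero_add,
    integral_inv_of_pos ha (by positivity), smul_eq_mul]
  have h2 : (K * a + a) / a = K + 1 := by field_simp
  rw [h2, div_eq_inv_mul]

/-- The one-dimensional Cauchy–Schwarz step in the proof of Polymath 8b Lemma 6.1 with the weight
of Cor. 6.4: if `g` vanishes outside `[0, a]` and `K > 0` then
`(∫₀¹ g)² ≤ (log (K+1) / K) · ∫ (a + K u) g(u)² du`, stated in `ℝ≥0∞` so that no integrability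
hypothesis is needed. [cite: Polymath8b2014, proof of Lemma 6.1] -/
theorem ofReal_sq_integral_le {g : ℝ → ℝ} (hg : Measurable g) {a K : ℝ} (hK : 0 < K)
    (hsupp : ∀ u, g u ≠ 0 → 0 ≤ u ∧ u ≤ a) :
    ENNReal.ofReal ((∫ u in (0:ℝ)..1, g u) ^ 2) ≤
      ENNReal.ofReal (Real.log (K + 1) / K) * ∫⁻ u, ENNReal.ofReal ((a + K * u) * g u ^ 2) := by
  rw [intervalIntegral.integral_of_le zero_le_one]
  rcases le_or_gt a 0 with ha | ha
  · -- `g` vanishes on `(0, 1]`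
    have h0 : ∫ u in Ioc (0:ℝ) 1, g u = 0 := by
      refine setIntegral_eq_zero_of_forall_eq_zero fun u hu => ?_
      by_contra h
      exact (not_le.2 hu.1) ((hsupp u h).2.trans ha)
    simp [h0]
  -- main case `a > 0`; the weight `a + K u` is positive on `[0, ∞)`
  have hpos : ∀ u : ℝ, 0 ≤ u → 0 < a + K * u := fun u hu => by positivity
  have hmeas : Measurable fun u : ℝ => a + K * u := by fun_prop
  obtain ⟨f₁, hf₁⟩ : ∃ f₁ : ℝ → ℝ≥0∞,
      f₁ = fun u => ENNReal.ofReal (|g u| * Real.sqrt (a + K * u)) := ⟨_, rfl⟩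
  obtain ⟨f₂, hf₂⟩ : ∃ f₂ : ℝ → ℝ≥0∞,
      f₂ = (Ioc 0 a).indicator fun u => ENNReal.ofReal ((Real.sqrt (a + K * u))⁻¹) := ⟨_, rfl⟩
  have hf₁m : Measurable f₁ := by
    rw [hf₁]
    exact ((continuous_abs.measurable.comp hg).mul
      (Real.continuous_sqrt.measurable.comp hmeas)).ennreal_ofReal
  have hf₂m : Measurable f₂ := by
    rw [hf₂]
    exact ((Real.continuous_sqrt.measurable.comp hmeas).inv.ennreal_ofReal).indicator
      measurableSet_Ioc
  -- Step 1: pass to `‖·‖ₑ`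
  have step1 : ENNReal.ofReal ((∫ u in Ioc (0:ℝ) 1, g u) ^ 2) ≤
      (∫⁻ u in Ioc (0:ℝ) 1, ‖g u‖ₑ) ^ 2 := by
    rw [← sq_abs, ENNReal.ofReal_pow (abs_nonneg _), ← Real.enorm_eq_ofReal_abs]
    gcongr
    exact enorm_integral_le_lintegral_enorm _
  -- Step 2: pointwise factorisation `|g| = (|g| √h) · (√h)⁻¹` on `(0, 1]`
  have step2 : ∫⁻ u in Ioc (0:ℝ) 1, ‖g u‖ₑ ≤ ∫⁻ u in Ioc (0:ℝ) 1, (f₁ * f₂) u := by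
    refine setLIntegral_mono' measurableSet_Ioc fun u hu => ?_
    by_cases hg0 : g u = 0
    · simp [hg0]
    obtain ⟨hu0, hua⟩ := hsupp u hg0
    have huS : u ∈ Ioc 0 a := ⟨hu.1, hua⟩
    have hsq : 0 < Real.sqrt (a + K * u) := Real.sqrt_pos.2 (hpos u hu0)
    simp only [hf₁, hf₂, Pi.mul_apply, indicator_of_mem huS]
    rw [← ENNReal.ofReal_mul (by positivity), Real.enorm_eq_ofReal_abs,
      mul_inv_cancel_right₀ hsq.ne']
  -- Step 3: Hölder with exponents `2, 2`
  have step3 : ∫⁻ u in Ioc (0:ℝ) 1, (f₁ * f₂) u ≤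
      (∫⁻ u in Ioc (0:ℝ) 1, f₁ u ^ (2:ℝ)) ^ (1 / 2 : ℝ) *
        (∫⁻ u in Ioc (0:ℝ) 1, f₂ u ^ (2:ℝ)) ^ (1 / 2 : ℝ) :=
    ENNReal.lintegral_mul_le_Lp_mul_Lq _ Real.HolderConjugate.two_two hf₁m.aemeasurable
      hf₂m.aemeasurable
  -- Step 4: the first factor is at most `∫ (a + K u) g²`
  have step4 : ∫⁻ u in Ioc (0:ℝ) 1, f₁ u ^ (2:ℝ) ≤
      ∫⁻ u, ENNReal.ofReal ((a + K * u) * g u ^ 2) := by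
    refine (setLIntegral_le_lintegral _ _).trans (lintegral_mono fun u => ?_)
    rw [ENNReal.rpow_two]
    by_cases hg0 : g u = 0
    · simp [hf₁, hg0]
    obtain ⟨hu0, -⟩ := hsupp u hg0
    simp only [hf₁]
    rw [← ENNReal.ofReal_pow (by positivity), mul_pow, Real.sq_sqrt (hpos u hu0).le, sq_abs,
      mul_comm]
  -- Step 5: the second factor is `∫₀^a du/(a + K u) = log (K+1)/K`
  have step5 : ∫⁻ u in Ioc (0:ℝ) 1, f₂ u ^ (2:ℝ) ≤ ENNReal.ofReal (Real.log (K + 1) / K) := by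
    have hint : IntegrableOn (fun u => (a + K * u)⁻¹) (Ioc 0 a) := by
      have hc : ContinuousOn (fun u => (a + K * u)⁻¹) (Icc 0 a) :=
        ContinuousOn.inv₀ (by fun_prop) fun u hu => (hpos u hu.1).ne'
      exact hc.integrableOn_Icc.mono_set Ioc_subset_Icc_self
    calc ∫⁻ u in Ioc (0:ℝ) 1, f₂ u ^ (2:ℝ)
        ≤ ∫⁻ u, f₂ u ^ (2:ℝ) := setLIntegral_le_lintegral _ _
      _ = ∫⁻ u, (Ioc 0 a).indicator (fun u => ENNReal.ofReal (a + K * u)⁻¹) u := by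
        refine lintegral_congr fun u => ?_
        rw [ENNReal.rpow_two]
        by_cases huS : u ∈ Ioc 0 a
        · simp only [hf₂, indicator_of_mem huS]
          rw [← ENNReal.ofReal_pow (by positivity), inv_pow, Real.sq_sqrt (hpos u huS.1.le).le]
        · simp [hf₂, huS]
      _ = ∫⁻ u in Ioc 0 a, ENNReal.ofReal (a + K * u)⁻¹ := lintegral_indicator measurableSet_Ioc _
      _ = ENNReal.ofReal (∫ u in Ioc 0 a, (a + K * u)⁻¹) := by
        refine (ofReal_integral_eq_lintegral_ofReal hint ?_).symm
        refine (ae_restrict_iff' measurableSet_Ioc).2 (ae_of_all _ fun u hu => ?_)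
        simp only [Pi.zero_apply]
        exact (inv_pos.2 (hpos u hu.1.le)).le
      _ = ENNReal.ofReal (Real.log (K + 1) / K) := by
        rw [← intervalIntegral.integral_of_le ha.le, integral_inv_add_mul ha hK]
  -- combine
  have hhalf : ∀ x : ℝ≥0∞, (x ^ (1 / 2 : ℝ)) ^ 2 = x := fun x => by
    rw [← ENNReal.rpow_two, ← ENNReal.rpow_mul]; norm_num
  calc ENNReal.ofReal ((∫ u in Ioc (0:ℝ) 1, g u) ^ 2)
      ≤ (∫⁻ u in Ioc (0:ℝ) 1, ‖g u‖ₑ) ^ 2 := step1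
    _ ≤ (∫⁻ u in Ioc (0:ℝ) 1, (f₁ * f₂) u) ^ 2 := by gcongr
    _ ≤ ((∫⁻ u in Ioc (0:ℝ) 1, f₁ u ^ (2:ℝ)) ^ (1 / 2 : ℝ) *
          (∫⁻ u in Ioc (0:ℝ) 1, f₂ u ^ (2:ℝ)) ^ (1 / 2 : ℝ)) ^ 2 := by gcongr
    _ = (∫⁻ u in Ioc (0:ℝ) 1, f₁ u ^ (2:ℝ)) * ∫⁻ u in Ioc (0:ℝ) 1, f₂ u ^ (2:ℝ) := by
          rw [mul_pow, hhalf, hhalf]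
    _ ≤ (∫⁻ u, ENNReal.ofReal ((a + K * u) * g u ^ 2)) * ENNReal.ofReal (Real.log (K + 1) / K) :=
          mul_le_mul' step4 step5
    _ = _ := mul_comm _ _

/-- For an admissible `F`, `F²` is integrable on the whole space (it vanishes off `R_k`).
[folklore] -/
theorem integrable_sq {k : ℕ} {F : (Fin k → ℝ) → ℝ} (hF : IsMaynardAdmissible k F) :
    Integrable fun t => F t ^ 2 :=
  hF.integrableOn_sq.integrable_of_forall_notMem_eq_zero fun t ht => by
    have : F t = 0 := Function.notMem_support.1 fun h => ht (hF.support_subset h)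
    simp [this]

/-- The weight `1 - ∑ᵢ tᵢ + k t_m = ((k-1)/log k) / G_m` of Polymath 8b Cor. 6.4 times `F²` is
nonnegative for admissible `F` (`G_m > 0` on `R_k`).
[cite: Polymath8b2014, proof of Corollary 6.4] -/
theorem weight_mul_sq_nonneg {n : ℕ} (m : Fin (n + 1)) {F : (Fin (n + 1) → ℝ) → ℝ}
    (hF : IsMaynardAdmissible (n + 1) F) (t : Fin (n + 1) → ℝ) :
    0 ≤ (1 - ∑ i, t i + (n + 1) * t m) * F t ^ 2 := by
  by_cases hFt : F t = 0
  · simp [hFt]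
  have ht : t ∈ maynardSimplex (n + 1) := hF.support_subset (Function.mem_support.2 hFt)
  refine mul_nonneg ?_ (sq_nonneg _)
  have h1 : 0 ≤ t m := ht.1 m
  have h2 : ∑ i, t i ≤ 1 := ht.2
  have : (0:ℝ) ≤ (n + 1) * t m := by positivity
  linarith

/-- Integrability of `(1 - ∑ᵢ tᵢ + k t_m) F(t)²` for admissible `F` (`k = n + 1`): on `R_k` the
weight lies in `[0, k + 1]`, and `F² = 0` off `R_k`. [folklore] -/
theorem integrable_weight_mul_sq {n : ℕ} (m : Fin (n + 1)) {F : (Fin (n + 1) → ℝ) → ℝ}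
    (hF : IsMaynardAdmissible (n + 1) F) :
    Integrable fun t : Fin (n + 1) → ℝ => (1 - ∑ i, t i + (n + 1) * t m) * F t ^ 2 := by
  have hwm : Measurable fun t : Fin (n + 1) → ℝ => 1 - ∑ i, t i + (n + 1) * t m :=
    (Continuous.measurable (by fun_prop))
  refine ((integrable_sq hF).const_mul ((n:ℝ) + 2)).mono'
    (hwm.mul (hF.measurable.pow_const 2)).aestronglyMeasurable (ae_of_all _ fun t => ?_)
  rw [Real.norm_eq_abs, abs_of_nonneg (weight_mul_sq_nonneg m hF t)]
  by_cases hFt : F t = 0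
  · simp [hFt]
  have ht : t ∈ maynardSimplex (n + 1) := hF.support_subset (Function.mem_support.2 hFt)
  refine mul_le_mul_of_nonneg_right ?_ (sq_nonneg _)
  have h1 : ∀ i, 0 ≤ t i := ht.1
  have h3 : t m ≤ 1 := (maynardSimplex_subset_maynardCube _ ht m (Set.mem_univ _)).2
  have h4 : 0 ≤ ∑ i, t i := Finset.sum_nonneg fun i _ => h1 i
  have h5 : (n + 1) * t m ≤ (n + 1) * (1:ℝ) := by gcongr
  linarith

/-- **Polymath 8b Lemma 6.1 with the weights of Cor. 6.4, one coordinate.** For `k = n + 1 ≥ 2`,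
`m ≤ k` and admissible `F`,
`J_k^{(m)}(F) ≤ (log k / (k−1)) ∫ (1 − ∑ᵢ tᵢ + k t_m) F(t)² dt`. Proof: split off the `m`-th
coordinate (`MeasurableEquiv.piFinSuccAbove`, volume preserving), apply the fibrewise
Cauchy–Schwarz bound `ofReal_sq_integral_le`, and reassemble by Tonelli.
[cite: Polymath8b2014, Lemma 6.1 and proof of Corollary 6.4] -/
theorem maynardJ_le {n : ℕ} (hn : 1 ≤ n) (m : Fin (n + 1)) {F : (Fin (n + 1) → ℝ) → ℝ}
    (hF : IsMaynardAdmissible (n + 1) F) :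
    maynardJ (n + 1) m F ≤
      Real.log (n + 1) / n * ∫ t, (1 - ∑ i, t i + (n + 1) * t m) * F t ^ 2 := by
  have hK : (0 : ℝ) < n := by exact_mod_cast hn
  have hc0 : 0 ≤ Real.log (n + 1) / n := div_nonneg (Real.log_nonneg (by linarith)) hK.le
  have hFm : Measurable F := hF.measurable
  -- the weight `w` and the integrand `G = ofReal (w F²)`
  obtain ⟨w, hw⟩ : ∃ w : (Fin (n + 1) → ℝ) → ℝ,
      w = fun t : Fin (n + 1) → ℝ => 1 - ∑ i, t i + (n + 1) * t m := ⟨_, rfl⟩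
  have hw_nonneg : ∀ t, 0 ≤ w t * F t ^ 2 := fun t => by
    rw [hw]; exact weight_mul_sq_nonneg m hF t
  have hint : Integrable fun t => w t * F t ^ 2 := by
    rw [hw]; exact integrable_weight_mul_sq m hF
  have hwm : Measurable w := by rw [hw]; exact Continuous.measurable (by fun_prop)
  obtain ⟨G, hG⟩ : ∃ G : (Fin (n + 1) → ℝ) → ℝ≥0∞,
      G = fun t => ENNReal.ofReal (w t * F t ^ 2) := ⟨_, rfl⟩
  have hGm : Measurable G := by rw [hG]; exact (hwm.mul (hFm.pow_const 2)).ennreal_ofReal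
  -- splitting off the `m`-th coordinate: `e.symm (x, s) = Fin.insertNth m x s`
  set e := MeasurableEquiv.piFinSuccAbove (fun _ : Fin (n + 1) => ℝ) m with he_def
  have he : MeasurePreserving e.symm volume volume :=
    (volume_preserving_piFinSuccAbove (fun _ : Fin (n + 1) => ℝ) m).symm
  have he_apply : ∀ p : ℝ × (Fin n → ℝ), e.symm p = Fin.insertNth m p.1 p.2 := fun p => by
    rw [he_def, MeasurableEquiv.piFinSuccAbove_symm_apply]; rfl
  -- the fibre integrals `Λ s = ∫ G (insertNth m u s) du`
  obtain ⟨Λ, hΛ⟩ : ∃ Λ : (Fin n → ℝ) → ℝ≥0∞, Λ = fun s => ∫⁻ u, G (e.symm (u, s)) := ⟨_, rfl⟩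
  have hΛm : Measurable Λ := by
    rw [hΛ]; exact (hGm.comp e.symm.measurable).lintegral_prod_left'
  -- fibrewise Cauchy–Schwarz
  have hfib : ∀ s : Fin n → ℝ,
      ENNReal.ofReal ((∫ u in (0:ℝ)..1, F (Fin.insertNth m u s)) ^ 2) ≤
        ENNReal.ofReal (Real.log (n + 1) / n) * Λ s := by
    intro s
    have hgm : Measurable fun u : ℝ => F (Fin.insertNth m u s) :=
      hFm.comp (continuous_id.finInsertNth m continuous_const).measurable
    refine (ofReal_sq_integral_le (a := 1 - ∑ j, s j) hgm hK ?_).trans (le_of_eq ?_)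
    · intro u hu
      have ht : Fin.insertNth m u s ∈ maynardSimplex (n + 1) :=
        hF.support_subset (Function.mem_support.2 hu)
      have h1 : ∀ i, 0 ≤ Fin.insertNth (α := fun _ => ℝ) m u s i := ht.1
      have h2 : ∑ i, Fin.insertNth (α := fun _ => ℝ) m u s i ≤ 1 := ht.2
      have hu0 : 0 ≤ u := by simpa using h1 m
      rw [Fin.sum_univ_succAbove _ m] at h2
      simp only [Fin.insertNth_apply_same, Fin.insertNth_apply_succAbove] at h2
      exact ⟨hu0, by linarith⟩
    · congr 1
      rw [hΛ]
      refine lintegral_congr fun u => ?_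
      rw [he_apply, hG]
      dsimp only
      rw [hw]
      dsimp only
      rw [Fin.sum_univ_succAbove _ m]
      simp only [Fin.insertNth_apply_same, Fin.insertNth_apply_succAbove]
      congr 1
      ring
  -- `cube ⊆ T := {t | t m ∈ [0,1]}` and `e.symm ⁻¹' T = [0,1] × univ`
  have hsub : maynardCube (n + 1) ⊆ {t | t m ∈ Icc (0:ℝ) 1} := fun t ht => ht m (Set.mem_univ _)
  have hpre : e.symm ⁻¹' {t : Fin (n + 1) → ℝ | t m ∈ Icc (0:ℝ) 1} =
      Icc (0:ℝ) 1 ×ˢ (univ : Set (Fin n → ℝ)) := by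
    ext ⟨x, s⟩
    simp [he_apply]
  -- Tonelli
  have hswap : ∫⁻ s, Λ s = ∫⁻ t, G t := by
    rw [← he.lintegral_comp_emb e.symm.measurableEmbedding G, Measure.volume_eq_prod, hΛ]
    exact (lintegral_prod_symm (G ∘ e.symm) (hGm.comp e.symm.measurable).aemeasurable).symm
  have hind : (maynardSimplex (n + 1)).indicator F = F := Set.indicator_eq_self.2 hF.support_subset
  have hmain : ENNReal.ofReal (maynardJ (n + 1) m F) ≤
      ENNReal.ofReal (Real.log (n + 1) / n) * ∫⁻ t, G t := by
    calc ENNReal.ofReal (maynardJ (n + 1) m F)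
        ≤ ‖maynardJ (n + 1) m F‖ₑ := Real.ofReal_le_enorm _
      _ ≤ ∫⁻ t in maynardCube (n + 1),
            ‖(∫ u in (0:ℝ)..1, F (Function.update t m u)) ^ 2‖ₑ := by
          rw [maynardJ, hind]; exact enorm_integral_le_lintegral_enorm _
      _ = ∫⁻ t in maynardCube (n + 1),
            ENNReal.ofReal ((∫ u in (0:ℝ)..1, F (Function.update t m u)) ^ 2) :=
          lintegral_congr fun t => Real.enorm_eq_ofReal (sq_nonneg _)
      _ ≤ ∫⁻ t in {t | t m ∈ Icc (0:ℝ) 1},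
            ENNReal.ofReal ((∫ u in (0:ℝ)..1, F (Function.update t m u)) ^ 2) :=
          lintegral_mono_set hsub
      _ = ∫⁻ p in e.symm ⁻¹' {t : Fin (n + 1) → ℝ | t m ∈ Icc (0:ℝ) 1},
            ENNReal.ofReal ((∫ u in (0:ℝ)..1, F (Function.update (e.symm p) m u)) ^ 2) :=
          (he.setLIntegral_comp_preimage_emb e.symm.measurableEmbedding _ _).symm
      _ = ∫⁻ p in Icc (0:ℝ) 1 ×ˢ (univ : Set (Fin n → ℝ)),
            ENNReal.ofReal ((∫ u in (0:ℝ)..1, F (Fin.insertNth m u p.2)) ^ 2) := by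
          rw [hpre]
          simp_rw [he_apply, Fin.update_insertNth]
      _ ≤ ∫⁻ p in Icc (0:ℝ) 1 ×ˢ (univ : Set (Fin n → ℝ)),
            ENNReal.ofReal (Real.log (n + 1) / n) * Λ p.2 := lintegral_mono fun p => hfib p.2
      _ = ∫⁻ s, ENNReal.ofReal (Real.log (n + 1) / n) * Λ s := by
          rw [Measure.volume_eq_prod, ← Measure.prod_restrict, Measure.restrict_univ]
          refine (lintegral_prod_symm (fun p : ℝ × (Fin n → ℝ) =>
            ENNReal.ofReal (Real.log (n + 1) / n) * Λ p.2) ?_).trans ?_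
          · exact ((hΛm.comp measurable_snd).const_mul _).aemeasurable
          · simp [lintegral_const, Real.volume_Icc]
      _ = ENNReal.ofReal (Real.log (n + 1) / n) * ∫⁻ s, Λ s := lintegral_const_mul _ hΛm
      _ = ENNReal.ofReal (Real.log (n + 1) / n) * ∫⁻ t, G t := by rw [hswap]
  -- back to real numbers
  have hlin : ∫⁻ t, G t = ENNReal.ofReal (∫ t, w t * F t ^ 2) := by
    rw [hG]; exact (ofReal_integral_eq_lintegral_ofReal hint (ae_of_all _ hw_nonneg)).symm
  rw [hlin, ← ENNReal.ofReal_mul hc0] at hmain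
  have := (ENNReal.ofReal_le_ofReal_iff (mul_nonneg hc0 (integral_nonneg hw_nonneg))).1 hmain
  rw [hw] at this
  exact this

end MaynardTao

open MaynardTao in
/-- **Polymath 8b upper bound `M_k ≤ (k/(k−1)) log k`, discharged** (D. H. J. Polymath, *Variants
of the Selberg sieve, and bounded intervals containing many primes*, Res. Math. Sci. 1:12 (2014),
Lemma 6.1 (Cauchy–Schwarz) and Corollary 6.4, p. 24 of arXiv:1407.4897v4). For `k ≥ 2` and every
admissible `F` (measurable, supported on `R_k`, square-integrable, `I_k(F) > 0`),
`(∑ₘ J_k^{(m)}(F)) / I_k(F) ≤ (k/(k−1)) log k`. Proof as printed: with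
`G_m(t) = ((k−1)/log k) / (1 − t₁ − ⋯ − t_k + k t_m)` one has `∫₀^∞ G_m dt_m ≤ 1` off a null set of
fibres and `∑ₘ 1/G_m = (k/(k−1)) log k` on `R_k`; Cauchy–Schwarz on each fibre gives
`J_k^{(m)}(F) ≤ ∫ F²/G_m` (`MaynardTao.maynardJ_le`), and summing over `m` gives the claim.
[cite: Polymath8b2014, Lemma 6.1 and Corollary 6.4] -/
theorem maynardFunctional_le_holds : maynardFunctional_le := by
  intro k hk F hF
  obtain ⟨n, rfl⟩ : ∃ n, k = n + 1 := ⟨k - 1, by omega⟩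
  have hn : 1 ≤ n := by omega
  have hK : (0:ℝ) < n := by exact_mod_cast hn
  have hI : maynardI (n + 1) F = ∫ t, F t ^ 2 := by
    refine setIntegral_eq_integral_of_forall_compl_eq_zero fun t ht => ?_
    have : F t = 0 := Function.notMem_support.1 fun h => ht (hF.support_subset h)
    simp [this]
  have hsum : ∀ t : Fin (n + 1) → ℝ, ∑ m, (1 - ∑ i, t i + (n + 1) * t m) = (n:ℝ) + 1 := fun t => by
    rw [Finset.sum_add_distrib, Finset.sum_const, Finset.card_univ, Fintype.card_fin,
      ← Finset.mul_sum, nsmul_eq_mul]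
    push_cast
    ring
  unfold maynardFunctional
  rw [div_le_iff₀ hF.maynardI_pos]
  calc ∑ m, maynardJ (n + 1) m F
      ≤ ∑ m, Real.log (n + 1) / n * ∫ t, (1 - ∑ i, t i + (n + 1) * t m) * F t ^ 2 :=
        Finset.sum_le_sum fun m _ => maynardJ_le hn m hF
    _ = Real.log (n + 1) / n * ∫ t, ∑ m, (1 - ∑ i, t i + (n + 1) * t m) * F t ^ 2 := by
        rw [integral_finsetSum _ fun m _ => integrable_weight_mul_sq m hF, Finset.mul_sum]
    _ = Real.log (n + 1) / n * ∫ t, ((n:ℝ) + 1) * F t ^ 2 := by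
        congr 1
        refine integral_congr_ae (ae_of_all _ fun t => ?_)
        dsimp only
        rw [← Finset.sum_mul, hsum t]
    _ = (↑(n + 1) : ℝ) / (↑(n + 1) - 1) * Real.log ↑(n + 1) * maynardI (n + 1) F := by
        rw [integral_const_mul, ← hI]
        push_cast
        ring

end Literature.NumberTheory.Sieve
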